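import Summits.BirchSwinnertonDyer.Rank1Residual.X2.AvatarValueAboveP
import Literature.NumberTheory.Automorphic.AdicCompletionDegreeOnePlaceEquiv
import Literature.NumberTheory.EllipticCurves.HeegnerPointsImaginaryQuadraticProofs
import HarnessLib

/-!
# The avatar at the prime above a SPLIT `p` of an imaginary quadratic field, in the binder shape
# of clause (AV-p) of `X2.LZZRoadInput`: `ι⁻¹(φ(ϖ_𝔭)) = ϖ^n · det r(σ𝔭)` with `ϖ ∈ {p, p⁻¹}` and a
# FIXED `σ𝔭 ∈ Γ_K` (cell `bsd-eis`, seat `bsd-eis-k5-c4` g7; route `EisensteinPrimes`, crux 4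
# `BSDpOnCellC` = stmt-BirchSwinnertonDyer-19034, line b1 v9, `stub_c2` at `p = 3`; RULING L51 (2)(1a):
# «item (1) of k5-c4: the avatar law AT 𝔭 in EXACTLY (AV-p)'s binder shape»)

HONEST FRAMING (cell `bsd-eis`): theorems only; nothing booked; no label or count moves; BSD is not proved.

## Why

cgshw g14's typed input `X2.LZZRoadInput` (p508124, `X2/CellCBDPValueLZZRoadInput.lean`; MEMO-18 §5)
renders Liu–Zhang–Zhang 2018 Thm. 3.8 ∧ Thm. 3.10 ∧ Prop. 4.12 in tree currency and carries ONE clause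
that is not analytic: (AV-p), the `p`-adic avatar of an interpolation character at the distinguished
prime `𝔭 ∣ p` — needed because the Steinberg root number `ε_k = −a_p·φ_k(ϖ_𝔭)` of the interpolation
formula brings `φ_k(ϖ_𝔭)` (p-adic valuation `n_k`) into the rescale `LZZRoadInput ⟹
X2.BDPValueContinuousDisplayAt` (cgshw part 2). The general local–global statement for ANY avatar is
`PNewDisplay.avatar_entry_eq_of_isPAdicAvatarOf` (`X2/AvatarValueAboveP.lean` §2, p509210):
`r(res_v w) = ι⁻¹(φ(⟨a w⟩_v)) · ∏_{e : K_v → ℚ̄_p} e(a w)^{−n_e}` — the Def. 1.5 ↔ `IsPAdicAvatarOf`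
DICTIONARY at the local idèles of `v ∣ p` (the citable name for the typist's implication
«FACT-LZZ ⟹ LZZRoadInput»). This file specialises it to the X2 datum — `K` imaginary quadratic, `p`
split, `𝔭 ∋ p` — where the local degree is `e(𝔭|p)·f(𝔭|p) = 1`, so that there is EXACTLY ONE
continuous embedding `K_𝔭 → ℚ̄_p` (§1) and its exponent in the type `(n, −n)` is `±n` (§2, `K` has no
real place); evaluating at the idèle `⟨p⟩_𝔭` (= `(1, p)` of LZZ Def. 1.5) gives (§3)
**`exists_varpi_sigma_symm_heckeValueExtZero_eq`**:

  `∃ (ϖ : ℚ_p) (σ𝔭 : Γ_K), (ϖ = p ∨ ϖ = p⁻¹) ∧ ∀ φ n r, 0 < n → (∀ v, φ unramified at v) →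
     φ of type (n, −n) → IsPAdicAvatarOf ι φ r → FactorsThroughZp κ r →
     ι⁻¹(heckeValueExtZero φ 𝔭) = (algebraMap ℚ_p ℚ̄_p ϖ)^n · det (r σ𝔭)`

— LITERALLY the (AV-p) conjunct of `LZZRoadInput` (there `∃ ϖ σ𝔭` sit among the input's witnesses),
under the input's standing hypotheses `IsImaginaryQuadratic K`, `((p)).primesOver.ncard = 2`, `p ∈ 𝔭`
(the orientation clause and `κ.IsAnticyclotomic` are not needed; `FactorsThroughZp κ r` is not used).
So the typist's implication discharges (AV-p) BY NAME, and the `@[conjecture]` residue of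
`LZZRoadInput` is its printed analytic content (L1)–(L6).

* §1 `exists_continuous_localEmbedding_of_degreeOne`, `localEmbedding_eq_of_degreeOne` — at a prime of
  degree one (`e = f = 1`) the completion `K_𝔭` is `ℚ_v ≅ ℚ_p` (`adicCompletionEquivOfDegreeOne`, a
  homeomorphism), so a continuous `K_𝔭 →+* ℚ̄_p` exists (`ℚ_p → ℚ̄_p`) and is unique (two continuous ring
  maps `ℚ_v → ℚ̄_p` agree on the dense `ℚ`); `univ_localEmbedding_eq_singleton`.
* §2 `embExponent_one_negOne_eq_or` — in a totally complex field the exponent of any embedding in the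
  type `(1, −1)` is `1` or `−1`.
* §3 `exists_varpi_sigma_symm_heckeValueExtZero_eq_core` (no `κ`), the theorem above (the input's
  binder shape verbatim), and `exists_varpi_sigma_avatarValueAt_mul_pow_eq` (the identity read in `ℂ_p`
  through `avatarValueAt`).

References: [SerreAbelianLadic1968] Ch. III §2.3 (local algebraicity of the avatar above `ℓ`);
[FrohlichTaylor1990] Ch. III §1 (1.14)(a) (`[K_w : F_v] = e f`); [LiuZhangZhang2018] Def. 1.5 / Duke
Def. 3.2.2 (the `ι`-avatar at `𝔭`; nothing of LZZ is asserted here).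
-/

noncomputable section

namespace Summit.BirchSwinnertonDyer.Rank1Residual.X2

open scoped Classical MatrixGroups NumberField Topology Polynomial
open Filter NumberField IsDedekindDomain IsDedekindDomain.HeightOneSpectrum Field Polynomial
open Literature Literature.NumberTheory.EllipticCurves Literature.NumberTheory.GaloisRepresentations
open Literature.NumberTheory.Automorphic

set_option autoImplicit false

namespace PNewDisplay

variable {p : ℕ} [Fact p.Prime] {K : Type} [Field K] [NumberField K]

/-! ### §1 The unique continuous embedding `K_𝔭 → ℚ̄_p` at a prime of degree one -/

section LocalEmbedding

/-- **At a prime `𝔭 ∣ p` of degree one (`e(𝔭|p) = f(𝔭|p) = 1`) a continuous ring map `K_𝔭 → ℚ̄_p`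
exists**: `K_𝔭 ≅ ℚ_v ≅ ℚ_p → ℚ̄_p` (the tree's degree-one isomorphism `adicCompletionEquivOfDegreeOne`,
Mathlib's `Padic.adicCompletionEquiv`, and the algebra map). [cite: FrohlichTaylor1990, Ch. III §1 (1.14)(a)] -/
theorem exists_continuous_localEmbedding_of_degreeOne {𝔭 : HeightOneSpectrum (𝓞 K)}
    (h𝔭 : ((p : ℕ) : 𝓞 K) ∈ 𝔭.asIdeal) (he : 𝔭.asIdeal.ramificationIdx (𝓞 ℚ) = 1)
    (hf : 𝔭.asIdeal.inertiaDeg (𝓞 ℚ) = 1) :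
    ∃ e : 𝔭.adicCompletion K →+* PadicAlgCl p, Continuous e := by
  haveI : 𝔭.asIdeal.LiesOver (X11b.ratPlace p).asIdeal :=
    ⟨by rw [← X11b.under_eq_ratPlace_of_mem h𝔭]; rfl⟩
  refine ⟨(algebraMap ℚ_[p] (PadicAlgCl p)).comp
      (((Padic.adicCompletionEquiv (𝓞 ℚ) ⟨p, Fact.out⟩).symm.toAlgEquiv.toRingEquiv.toRingHom).comp
        (adicCompletionEquivOfDegreeOne ℚ K (X11b.ratPlace p) 𝔭 he hf).symm.toRingHom), ?_⟩
  exact (continuous_algebraMap ℚ_[p] (PadicAlgCl p)).comp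
    ((Padic.adicCompletionEquiv (𝓞 ℚ) ⟨p, Fact.out⟩).symm.continuous.comp
      (continuous_adicCompletionEquivOfDegreeOne_symm ℚ K (X11b.ratPlace p) 𝔭 he hf))

/-- **… and it is unique**: two continuous ring maps `K_𝔭 → ℚ̄_p` coincide, because composed with the
degree-one isomorphism `ℚ_v ≅ K_𝔭` they are continuous ring maps `ℚ_v → ℚ̄_p`, which agree on the dense
image of `ℚ`. [cite: FrohlichTaylor1990, Ch. III §1 (1.14)(a)] -/
theorem localEmbedding_eq_of_degreeOne {𝔭 : HeightOneSpectrum (𝓞 K)}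
    (h𝔭 : ((p : ℕ) : 𝓞 K) ∈ 𝔭.asIdeal) (he : 𝔭.asIdeal.ramificationIdx (𝓞 ℚ) = 1)
    (hf : 𝔭.asIdeal.inertiaDeg (𝓞 ℚ) = 1) {e e' : 𝔭.adicCompletion K →+* PadicAlgCl p}
    (hec : Continuous e) (hec' : Continuous e') : e = e' := by
  haveI : 𝔭.asIdeal.LiesOver (X11b.ratPlace p).asIdeal :=
    ⟨by rw [← X11b.under_eq_ratPlace_of_mem h𝔭]; rfl⟩
  set j := adicCompletionEquivOfDegreeOne ℚ K (X11b.ratPlace p) 𝔭 he hf with hj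
  have hjc : Continuous j := continuous_adicCompletionEquivOfDegreeOne ℚ K (X11b.ratPlace p) 𝔭 he hf
  -- the two composites `ℚ_v → ℚ̄_p` agree on `ℚ`, hence everywhere
  have hrat : ((e.comp j.toRingHom).comp (algebraMap ℚ ((X11b.ratPlace p).adicCompletion ℚ)) :
      ℚ →+* PadicAlgCl p) =
      (e'.comp j.toRingHom).comp (algebraMap ℚ ((X11b.ratPlace p).adicCompletion ℚ)) :=
    RingHom.ext_rat _ _
  have hcomp : (e.comp j.toRingHom : (X11b.ratPlace p).adicCompletion ℚ → PadicAlgCl p) =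
      (e'.comp j.toRingHom) := by
    refine (IsDedekindDomain.HeightOneSpectrum.denseRange_algebraMap (K := ℚ)
      (X11b.ratPlace p)).equalizer (hec.comp hjc) (hec'.comp hjc) ?_
    funext q
    exact RingHom.congr_fun hrat q
  refine RingHom.ext fun y ↦ ?_
  have hy : y = j (j.symm y) := (j.apply_symm_apply y).symm
  have h := congrFun hcomp (j.symm y)
  simp only [RingHom.coe_comp, Function.comp_apply] at h
  rw [hy]
  exact h

/-- The finite type of continuous embeddings `K_𝔭 → ℚ̄_p` at a prime of degree one is the singleton
`{e₀}` of any of its members. [folklore] -/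
theorem univ_localEmbedding_eq_singleton {𝔭 : HeightOneSpectrum (𝓞 K)}
    (h𝔭 : ((p : ℕ) : 𝓞 K) ∈ 𝔭.asIdeal) (he : 𝔭.asIdeal.ramificationIdx (𝓞 ℚ) = 1)
    (hf : 𝔭.asIdeal.inertiaDeg (𝓞 ℚ) = 1)
    (e₀ : {e : 𝔭.adicCompletion K →+* PadicAlgCl p // Continuous e}) :
    (Finset.univ : Finset {e : 𝔭.adicCompletion K →+* PadicAlgCl p // Continuous e}) = {e₀} := by
  refine Finset.eq_singleton_iff_unique_mem.mpr ⟨Finset.mem_univ _, fun f _ ↦ ?_⟩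
  exact Subtype.ext (localEmbedding_eq_of_degreeOne h𝔭 he hf f.2 e₀.2)

end LocalEmbedding

/-! ### §2 The exponent of an embedding of a totally complex field in the type `(1, −1)` is `±1` -/

section Sign

omit [NumberField K] in
/-- In a totally complex field no embedding is real, so the exponent of `τ : K → ℂ` in the infinity
type `(1, −1)` (`1` at the distinguished embedding of each place, `−1` at its conjugate) is `1` or `−1`.
[folklore] -/
theorem embExponent_one_negOne_eq_or [NumberField.IsTotallyComplex K] (τ : K →+* ℂ) :
    HeckeCharacter.embExponent (fun _ : InfinitePlace K ↦ (1 : ℤ)) (fun _ ↦ (-1 : ℤ)) τ = 1 ∨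
      HeckeCharacter.embExponent (fun _ : InfinitePlace K ↦ (1 : ℤ)) (fun _ ↦ (-1 : ℤ)) τ = -1 := by
  have hτ : ¬ ComplexEmbedding.IsReal τ := fun h ↦
    (InfinitePlace.not_isReal_iff_isComplex.mpr
      (NumberField.IsTotallyComplex.isComplex (InfinitePlace.mk τ))) ⟨τ, h, rfl⟩
  unfold HeckeCharacter.embExponent
  by_cases h : τ = (InfinitePlace.mk τ).embedding
  · left; rw [if_neg hτ, if_pos h]
  · right; rw [if_neg hτ, if_neg h]

end Sign

/-! ### §3 (AV-p): `ι⁻¹(φ(ϖ_𝔭)) = ϖ^n · det r(σ𝔭)`, `ϖ ∈ {p, p⁻¹}`, at the prime above a split `p` -/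

section AVp

/-- `∏_i a^{f i} = a^{Σ_i f i}`-free bookkeeping: `(a^s)^n · a^{−(n·s)} = 1` for `a ≠ 0`. [folklore] -/
private theorem zpow_pow_mul_zpow_neg_eq_one {F : Type*} [Field F] {a : F} (ha : a ≠ 0) (s : ℤ) (n : ℕ) :
    (a ^ s) ^ n * a ^ (-((n : ℤ) * s)) = 1 := by
  rw [← zpow_natCast, ← zpow_mul, ← zpow_add₀ ha, show s * (n : ℤ) + -((n : ℤ) * s) = 0 by ring,
    zpow_zero]

/-- **The avatar at the prime above a split `p` — core statement.** Let `K` be imaginary quadratic,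
`p` split in `K` (two primes above `p`), `𝔭 ∋ p`, `ι : ℚ̄_p ≃ ℂ` an embedding datum. There are
`ϖ ∈ {p, p⁻¹} ⊂ ℚ_p` and a FIXED `σ𝔭 ∈ Γ_K` such that for every everywhere-unramified Hecke character `φ`
of infinity type `(n, −n)` and every `p`-adic avatar `r` of `φ` (`IsPAdicAvatarOf ι φ r`):
`ι⁻¹(φ(ϖ_𝔭)) = ϖ^n · det r(σ𝔭)` in `ℚ̄_p` (`φ(ϖ_𝔭)` = the tree's `heckeValueExtZero φ 𝔭`). PROOF:
`σ𝔭` = the restriction of a Weil element `w₀` of `K_𝔭` with `a(w₀) = p` for a local Artin map `a`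
(`exists_isLocalArtinMap_holds`, surjectivity clause); local–global compatibility for any avatar
(`avatar_entry_eq_of_isPAdicAvatarOf`): `det r(σ𝔭) = ι⁻¹(φ(⟨p⟩_𝔭)) · ∏_e e(p)^{−n_e}`; `p` splits, so
`e(𝔭|p) = f(𝔭|p) = 1` (`X11b.degreeOne_of_splitsIn`), `φ(⟨p⟩_𝔭) = φ(ϖ_𝔭)`
(`coe_map_localUnits_natCast_eq_valueAtUniformizer_pow`), the product has ONE factor (§1) with `e(p) = p`
and exponent `n_e = ±n` (§2 — `K` totally complex), i.e. `det r(σ𝔭) = ι⁻¹(φ(ϖ_𝔭)) · p^{∓n}`; take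
`ϖ := p^{±1}`. This is LZZ Def. 1.5 (Duke Def. 3.2.2) «`χ^{(ι)}_𝔭(t) = ι((t_𝔓/t_{𝔓^c})^{−w}χ_𝔭(t))`» at
the idèle `(1, p)`, for the tree's avatars. [cite: SerreAbelianLadic1968, Ch. III §2.3]
[cite: LiuZhangZhang2018, Def. 1.5 (arXiv:1511.08172 p. 4) = Duke Def. 3.2.2 (the ι-avatar; nothing of LZZ asserted)] -/
theorem exists_varpi_sigma_symm_heckeValueExtZero_eq_core (ι : PadicAlgCl p ≃+* ℂ)
    (hK : IsImaginaryQuadratic K) (hs : ((Ideal.span {(p : ℤ)}).primesOver (𝓞 K)).ncard = 2)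
    {𝔭 : HeightOneSpectrum (𝓞 K)} (h𝔭 : ((p : ℕ) : 𝓞 K) ∈ 𝔭.asIdeal) :
    ∃ (ϖ : ℚ_[p]) (σ𝔭 : absoluteGaloisGroup K), (ϖ = p ∨ ϖ = (p : ℚ_[p])⁻¹) ∧
      ∀ (φ : HeckeCharacter K) (n : ℕ) (r : FramedGaloisRep K (PadicAlgCl p) 1),
        (∀ v : HeightOneSpectrum (𝓞 K), φ.IsUnramifiedAt v) →
        φ.HasInfinityType (fun _ ↦ (n : ℤ)) (fun _ ↦ -(n : ℤ)) → IsPAdicAvatarOf ι φ r →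
        ι.symm (heckeValueExtZero φ 𝔭) = (algebraMap ℚ_[p] (PadicAlgCl p) ϖ) ^ n *
            ((Matrix.GeneralLinearGroup.det (r σ𝔭) : (PadicAlgCl p)ˣ) : PadicAlgCl p) := by
  classical
  haveI : NumberField.IsTotallyComplex K := hK.2
  have hp : p.Prime := Fact.out
  obtain ⟨he, hf⟩ := X11b.degreeOne_of_splitsIn hK.1 hs h𝔭
  -- the Artin map, the idèle `⟨p⟩_𝔭 = a(w₀)`, and `σ𝔭`
  obtain ⟨a, ha⟩ := exists_isLocalArtinMap_holds (𝔭.adicCompletion K)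
  have hp0 : algebraMap K (𝔭.adicCompletion K) (p : K) ≠ 0 := by
    rw [_root_.map_ne_zero]; exact_mod_cast hp.ne_zero
  set z : (𝔭.adicCompletion K)ˣ := Units.mk0 _ hp0 with hz
  obtain ⟨w₀, hw₀⟩ := ha.isOpenQuotientMap_artin.surjective z
  -- the unique local embedding and its sign
  obtain ⟨e₀, he₀⟩ := exists_continuous_localEmbedding_of_degreeOne h𝔭 he hf
  set s₀ : ℤ := HeckeCharacter.embExponent (fun _ : InfinitePlace K ↦ (1 : ℤ)) (fun _ ↦ (-1 : ℤ))
    ((ι : PadicAlgCl p →+* ℂ).comp (e₀.comp (algebraMap K (𝔭.adicCompletion K)))) with hs₀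
  have hs₀' : s₀ = 1 ∨ s₀ = -1 := embExponent_one_negOne_eq_or _
  have hpc : (p : PadicAlgCl p) ≠ 0 := by exact_mod_cast hp.ne_zero
  refine ⟨(p : ℚ_[p]) ^ s₀,
    absGaloisRestrict K (𝔭.adicCompletion K) (WeilGroup.toAbsGalois (𝔭.adicCompletion K) w₀), ?_,
    fun φ n r hunr hinf hav ↦ ?_⟩
  · rcases hs₀' with h | h
    · left; rw [h, zpow_one]
    · right; rw [h, zpow_neg_one]
  -- local–global compatibility at `𝔭` for the avatar `r`
  have key := avatar_entry_eq_of_isPAdicAvatarOf hinf ι (T := ∅) (fun w _ ↦ hunr w) hav h𝔭 a ha w₀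
  rw [hw₀, univ_localEmbedding_eq_singleton h𝔭 he hf ⟨e₀, he₀⟩, Finset.prod_singleton] at key
  -- the single factor: `e₀(p) = p` with exponent `n·s₀`
  have hfz : e₀ ((z : (𝔭.adicCompletion K)ˣ) : 𝔭.adicCompletion K) = (p : PadicAlgCl p) := by
    rw [hz, Units.val_mk0, map_natCast, map_natCast]
  have hval : (φ (localUnits 𝔭 z) : ℂ) = heckeValueExtZero φ 𝔭 := by
    rw [coe_map_localUnits_natCast_eq_valueAtUniformizer_pow h𝔭 (hunr 𝔭) (z := z) rfl, he, pow_one,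
      heckeValueExtZero_of_isUnramifiedAt (hunr 𝔭)]
  rw [hfz, embExponent_const_eq_mul, hval] at key
  -- assemble
  rw [Matrix.GeneralLinearGroup.val_det_apply, Matrix.det_fin_one, key, map_zpow₀, map_natCast,
    ← mul_assoc, mul_comm (((p : PadicAlgCl p) ^ s₀) ^ n), mul_assoc]
  -- goal: `ι⁻¹ν = ι⁻¹ν · ((p^{s₀})^n · p^{−n s₀})`
  have hexp : HeckeCharacter.embExponent (fun _ : InfinitePlace K ↦ (1 : ℤ)) (fun _ ↦ (-1 : ℤ))
      ((ι : PadicAlgCl p →+* ℂ).comp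
        ((⟨e₀, he₀⟩ : {e : 𝔭.adicCompletion K →+* PadicAlgCl p // Continuous e}).1.comp
          (algebraMap K (𝔭.adicCompletion K)))) = s₀ := rfl
  rw [hexp, zpow_pow_mul_zpow_neg_eq_one hpc s₀ n, mul_one]

/-- **(AV-p) of `X2.LZZRoadInput`, VERBATIM, as a theorem** (RULING L51 (2)(1a)): under the input's
standing hypotheses `IsImaginaryQuadratic K`, `((p)).primesOver.ncard = 2`, `p ∈ 𝔭` (and any `κ`),
`∃ (ϖ : ℚ_p) (σ𝔭 : Γ_K), (ϖ = p ∨ ϖ = p⁻¹) ∧ ∀ φ n r, 0 < n → (∀ v, φ.IsUnramifiedAt v) →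
φ.HasInfinityType (n) (−n) → IsPAdicAvatarOf ι φ r → FactorsThroughZp κ r →
ι⁻¹(heckeValueExtZero φ 𝔭) = (algebraMap ℚ_p ℚ̄_p ϖ)^n · det (r σ𝔭)` — the core statement with the
input's two extra (unused) binders `0 < n` and `FactorsThroughZp κ r`. The typist's implication
«FACT-LZZ ⟹ X2.LZZRoadInput» discharges clause (AV-p) by this name. [cite: SerreAbelianLadic1968, Ch. III §2.3]
[cite: LiuZhangZhang2018, Def. 1.5 (arXiv:1511.08172 p. 4) = Duke Def. 3.2.2 (nothing of LZZ asserted)] -/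
theorem exists_varpi_sigma_symm_heckeValueExtZero_eq (ι : PadicAlgCl p ≃+* ℂ)
    (hK : IsImaginaryQuadratic K) (hs : ((Ideal.span {(p : ℤ)}).primesOver (𝓞 K)).ncard = 2)
    {𝔭 : HeightOneSpectrum (𝓞 K)} (h𝔭 : ((p : ℕ) : 𝓞 K) ∈ 𝔭.asIdeal) (κ : ZpExtension K p) :
    ∃ (ϖ : ℚ_[p]) (σ𝔭 : absoluteGaloisGroup K), (ϖ = p ∨ ϖ = (p : ℚ_[p])⁻¹) ∧
      ∀ (φ : HeckeCharacter K) (n : ℕ) (r : FramedGaloisRep K (PadicAlgCl p) 1), 0 < n →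
        (∀ v : HeightOneSpectrum (𝓞 K), φ.IsUnramifiedAt v) →
        φ.HasInfinityType (fun _ ↦ (n : ℤ)) (fun _ ↦ -(n : ℤ)) →
        IsPAdicAvatarOf ι φ r → FactorsThroughZp κ r →
        ι.symm (heckeValueExtZero φ 𝔭) = (algebraMap ℚ_[p] (PadicAlgCl p) ϖ) ^ n *
            ((Matrix.GeneralLinearGroup.det (r σ𝔭) : (PadicAlgCl p)ˣ) : PadicAlgCl p) := by
  obtain ⟨ϖ, σ𝔭, hϖ, h⟩ := exists_varpi_sigma_symm_heckeValueExtZero_eq_core ι hK hs h𝔭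
  exact ⟨ϖ, σ𝔭, hϖ, fun φ n r _ hunr hinf hav _ ↦ h φ n r hunr hinf hav⟩

/-- **(AV-p) read in `ℂ_p` through `avatarValueAt`**: with `ϖ, σ𝔭` as above,
`avatarValueAt r σ𝔭 · ϖ^n = ι⁻¹(φ(ϖ_𝔭))` in `ℂ_p` — the form in which the rescale's limit
`r_k(σ𝔭) → 1` (uniform avatar convergence, `eventually_forall_norm_avatarValueAt_sub_one_lt`) reads the
Steinberg factor `φ_k(ϖ_𝔭)` as `ϖ^{n_k} × (→ 1)`. [cite: SerreAbelianLadic1968, Ch. III §2.3] -/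
theorem exists_varpi_sigma_avatarValueAt_mul_pow_eq (ι : PadicAlgCl p ≃+* ℂ)
    (hK : IsImaginaryQuadratic K) (hs : ((Ideal.span {(p : ℤ)}).primesOver (𝓞 K)).ncard = 2)
    {𝔭 : HeightOneSpectrum (𝓞 K)} (h𝔭 : ((p : ℕ) : 𝓞 K) ∈ 𝔭.asIdeal) :
    ∃ (ϖ : ℚ_[p]) (σ𝔭 : absoluteGaloisGroup K), (ϖ = p ∨ ϖ = (p : ℚ_[p])⁻¹) ∧
      ∀ (φ : HeckeCharacter K) (n : ℕ) (r : FramedGaloisRep K (PadicAlgCl p) 1),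
        (∀ v : HeightOneSpectrum (𝓞 K), φ.IsUnramifiedAt v) →
        φ.HasInfinityType (fun _ ↦ (n : ℤ)) (fun _ ↦ -(n : ℤ)) → IsPAdicAvatarOf ι φ r →
        avatarValueAt r σ𝔭 * algebraMap ℚ_[p] ℂ_[p] ϖ ^ n =
          ((ι.symm (heckeValueExtZero φ 𝔭) : PadicAlgCl p) : ℂ_[p]) := by
  obtain ⟨ϖ, σ𝔭, hϖ, h⟩ := exists_varpi_sigma_symm_heckeValueExtZero_eq_core ι hK hs h𝔭
  refine ⟨ϖ, σ𝔭, hϖ, fun φ n r hunr hinf hav ↦ ?_⟩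
  rw [h φ n r hunr hinf hav, avatarValueAt]
  show algebraMap (PadicAlgCl p) ℂ_[p]
      ((Matrix.GeneralLinearGroup.det (r σ𝔭) : (PadicAlgCl p)ˣ) : PadicAlgCl p) *
      algebraMap ℚ_[p] ℂ_[p] ϖ ^ n =
    algebraMap (PadicAlgCl p) ℂ_[p] ((algebraMap ℚ_[p] (PadicAlgCl p) ϖ) ^ n *
      ((Matrix.GeneralLinearGroup.det (r σ𝔭) : (PadicAlgCl p)ˣ) : PadicAlgCl p))
  rw [map_mul, map_pow, ← IsScalarTower.algebraMap_apply, mul_comm]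

end AVp

end PNewDisplay

end Summit.BirchSwinnertonDyer.Rank1Residual.X2

end
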